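import Summits.KontsevichZagierPeriods.KontsevichZagierPeriods.Theses.IsogenyCertificates
import Summits.KontsevichZagierPeriods.KontsevichZagierPeriods.Theorems.XMapPeriodTransfer.Negative.LoadBearingDatum
import Summits.KontsevichZagierPeriods.KontsevichZagierPeriods.Theorems.XMapPeriodTransfer.Negative.ValueEqLoadBearing
import Literature.NumberTheory.Transcendental.KZLogCalculusProofs
import Literature.NumberTheory.Transcendental.KZSemiCanonicalReductionProofs
import Literature.ModelTheory.ExponentialFields.SemialgebraicComponents

/-!
# `XMapPeriodTransfer` (stmt-KontsevichZagierPeriods-10665) — line `saturated-sign-cells`, SKELETON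

Crux `Summit.KontsevichZagierPeriods.KontsevichZagierPeriods.Theses.IsogenyCertificates.XMapPeriodTransfer`
(route IsogenyCertificates, rank 3): for an x-rational isogeny datum `(f, g, c)` between
`y² = P(x) = x³ + Ax + B` and `y² = P'(x)`, equal-valued real-period representations
`[{P>0}, a/√P]`, `[{P'>0}, b/√P']` are KZ-equivalent.

## The line (card `saturated-sign-cells`; egg′↔U′ step by card `double-first-descent`)

No definitions are introduced: throughout, for a datum `(f, g, c)`,
`R = fun y => aeval y f / aeval y g` is the real x-map, `W = fun y => aeval y (f'g − fg')` the real
Wronskian, `L = {y | 0 < P y ∧ W y ≠ 0}` the CELL LOCUS (its connected components are the cells), and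
for a curve `U = connectedComponentIn {P > 0} (1 + |A| + |B|)` is the UNBOUNDED COMPONENT and
`{P > 0} ∖ U` the EGG; stubs take these as variables with defining equations.

WLOG `f, g` coprime (`XMapPeriodTransferDatum.iff_coprime`, landed). On a cell `R` has no pole,
`R' = W/g² ≠ 0` and `c²·P'(R) = P·R'² > 0`, so `R` is strictly monotone (`stub_cellMonotone`); the
one-sided limits of `R` at cell ends are roots of `P'` or infinite (`stub_cellEnds`: at a finite end
`P·W = 0`; at `+∞` compare top coefficients in the identity), hence the image of a cell is a whole
component of `{P' > 0}` (`stub_intervalImage`, `stub_cubicComponents`). Rule (2) along `R` moves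
`[cell, a/√P]` onto `[image, (a/|c|)/√P']` (`stub_cellMove`); finite domain additivity and integrand
merges give the CENSUS `[K, a/√P] ≡ [U', (m_U a/|c|)/√P'] + [egg', (m_E a/|c|)/√P']` for every
saturated source piece `K` (`stub_cellCensus`). The duplication datum
`(X⁴ − 2A'X² − 8B'X + A'², 4P', 2)` on the TARGET curve is a coprime datum of the same shape whose
cells all land on `U'` (2-descent square identity, `stub_dupDatum`), so two more censuses push
`[U', ·]` and `[egg', ·]` — for both `[r]` and `[r']` — onto `[U', γ/√P']`, `[U', γ'/√P']` with RATIONAL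
`γ, γ'`; soundness, `r.value = r'.value` and `∫_{U'} dx/√P' > 0` give `γ = γ'`; equal integrands on a
common domain are one integrand-additivity move apart. Value equality is used exactly once, in this
last step (cf. `XMapPeriodTransferValue.false_without_valueEq`).

`XMapPeriodTransfer_of` proves the crux BY NAME from the registered stubs `stub_*` (the only
`sorry`s in this file; `stub_cellsBasic` is the basic-API helper of the line).
-/

noncomputable section

open Set Filter MeasureTheory Polynomial Topology
open Literature.NumberTheory.Transcendental
open Literature.ModelTheory.ExponentialFields (IsSemialgebraic)
open Summit.KontsevichZagierPeriods.KontsevichZagierPeriods.Theses.IsogenyCertificates (XMapPeriodTransfer)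

namespace Summit.KontsevichZagierPeriods.IsogenyCertificates.XMapPeriodTransferCells

/-! ## Registered stubs -/

/-- STUB (basic API of the line, helper): `P > 0` beyond `1 + |A| + |B|`; `ℚ`-semialgebraicity of the
`ℝ¹`-traces of `{P > 0}`, of the cells, of the unbounded component and of the egg; finiteness of the
set of components of the trace of a `ℚ`-semialgebraic set; finite traces are null. -/
theorem stub_cellsBasic :
    (∀ (A B : ℤ) (z : ℝ), 1 + |(A : ℝ)| + |(B : ℝ)| ≤ z → 0 < z ^ 3 + (A : ℝ) * z + (B : ℝ)) ∧
    (∀ (A B : ℤ), IsSemialgebraic ℚ {x : Fin 1 → ℝ | x 0 ∈ {y : ℝ | 0 < y ^ 3 + (A : ℝ) * y + (B : ℝ)}}) ∧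
    (∀ (A B : ℤ) (f g : ℚ[X]) (y : ℝ), IsSemialgebraic ℚ {x : Fin 1 → ℝ | x 0 ∈ connectedComponentIn
      {y : ℝ | 0 < y ^ 3 + (A : ℝ) * y + (B : ℝ) ∧ aeval y (derivative f * g - f * derivative g) ≠ 0} y}) ∧
    (∀ (A B : ℤ), IsSemialgebraic ℚ {x : Fin 1 → ℝ | x 0 ∈
      connectedComponentIn {y : ℝ | 0 < y ^ 3 + (A : ℝ) * y + (B : ℝ)} (1 + |(A : ℝ)| + |(B : ℝ)|)}) ∧
    (∀ (A B : ℤ), IsSemialgebraic ℚ {x : Fin 1 → ℝ | x 0 ∈ {y : ℝ | 0 < y ^ 3 + (A : ℝ) * y + (B : ℝ)} \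
      connectedComponentIn {y : ℝ | 0 < y ^ 3 + (A : ℝ) * y + (B : ℝ)} (1 + |(A : ℝ)| + |(B : ℝ)|)}) ∧
    (∀ (S : Set ℝ), IsSemialgebraic ℚ {x : Fin 1 → ℝ | x 0 ∈ S} →
      {K : Set ℝ | ∃ y ∈ S, K = connectedComponentIn S y}.Finite) ∧
    (∀ (F : Set ℝ), F.Finite → volume {x : Fin 1 → ℝ | x 0 ∈ F} = 0) := by
  sorry

/-- STUB (E1, cell structure and monotonicity). On a cell `C` (the connected component of `x₀` in
the cell locus `L`): `g ≠ 0`, `P'(R) > 0`, `R` is differentiable with `R' = W/g²`, `R` is strictly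
monotone or antitone on `C`, and `C = (p, ∞)` or `C = (p, q)` with `P·W = 0` at the finite ends. -/
theorem stub_cellMonotone : ∀ (A B A' B' : ℤ) (f g : ℚ[X]) (c : ℚ),
    derivative f * g - f * derivative g ≠ 0 →
    C (c ^ 2) * g * (f ^ 3 + C (A' : ℚ) * f * g ^ 2 + C (B' : ℚ) * g ^ 3) =
      (X ^ 3 + C (A : ℚ) * X + C (B : ℚ)) * (derivative f * g - f * derivative g) ^ 2 →
    ∀ (R W : ℝ → ℝ) (L : Set ℝ), R = (fun y => aeval y f / aeval y g) →
      W = (fun y => aeval y (derivative f * g - f * derivative g)) →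
      L = {y : ℝ | 0 < y ^ 3 + (A : ℝ) * y + (B : ℝ) ∧ W y ≠ 0} →
    ∀ x₀ ∈ L,
      (∀ x ∈ connectedComponentIn L x₀,
          aeval x g ≠ 0 ∧ 0 < R x ^ 3 + (A' : ℝ) * R x + (B' : ℝ) ∧
          HasDerivAt R (W x / (aeval x g) ^ 2) x) ∧
      (StrictMonoOn R (connectedComponentIn L x₀) ∨ StrictAntiOn R (connectedComponentIn L x₀)) ∧
      ∃ p : ℝ, p < x₀ ∧ (p ^ 3 + (A : ℝ) * p + (B : ℝ)) * W p = 0 ∧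
        (connectedComponentIn L x₀ = Ioi p ∨
          ∃ q : ℝ, x₀ < q ∧ (q ^ 3 + (A : ℝ) * q + (B : ℝ)) * W q = 0 ∧
            connectedComponentIn L x₀ = Ioo p q) := by
  sorry

/-- STUB (E2, end limits). For a COPRIME datum: at every real `p` with `P(p)·W(p) = 0` the x-map has
a punctured limit which is a root of `P'`, or `|R| → ∞`; and at `+∞` the same alternative holds. -/
theorem stub_cellEnds : ∀ (A B A' B' : ℤ) (f g : ℚ[X]) (c : ℚ),
    derivative f * g - f * derivative g ≠ 0 →
    C (c ^ 2) * g * (f ^ 3 + C (A' : ℚ) * f * g ^ 2 + C (B' : ℚ) * g ^ 3) =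
      (X ^ 3 + C (A : ℚ) * X + C (B : ℚ)) * (derivative f * g - f * derivative g) ^ 2 →
    IsCoprime f g →
    ∀ (R W : ℝ → ℝ), R = (fun y => aeval y f / aeval y g) →
      W = (fun y => aeval y (derivative f * g - f * derivative g)) →
    (∀ p : ℝ, (p ^ 3 + (A : ℝ) * p + (B : ℝ)) * W p = 0 →
        (∃ ℓ : ℝ, ℓ ^ 3 + (A' : ℝ) * ℓ + (B' : ℝ) = 0 ∧ Tendsto R (𝓝[≠] p) (𝓝 ℓ)) ∨
          Tendsto (fun x => |R x|) (𝓝[≠] p) atTop) ∧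
    ((∃ ℓ : ℝ, ℓ ^ 3 + (A' : ℝ) * ℓ + (B' : ℝ) = 0 ∧ Tendsto R atTop (𝓝 ℓ)) ∨
      Tendsto (fun x => |R x|) atTop atTop) := by
  sorry

/-- STUB (E3, pure real analysis). A continuous strictly monotone function on an open interval `C`
bounded below, with values in `{P' > 0}` and one-sided end limits each a root of `P'` or infinite in
absolute value, maps `C` onto `(u, ∞)` or `(u, v)` with `u < v` roots of `P'`. -/
theorem stub_intervalImage : ∀ (A' B' : ℤ) (φ : ℝ → ℝ) (C : Set ℝ) (p : ℝ),
    (C = Ioi p ∨ ∃ q : ℝ, p < q ∧ C = Ioo p q) →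
    ContinuousOn φ C → (StrictMonoOn φ C ∨ StrictAntiOn φ C) →
    φ '' C ⊆ {y : ℝ | 0 < y ^ 3 + (A' : ℝ) * y + (B' : ℝ)} →
    ((∃ ℓ : ℝ, ℓ ^ 3 + (A' : ℝ) * ℓ + (B' : ℝ) = 0 ∧ Tendsto φ (𝓝[>] p) (𝓝 ℓ)) ∨
      Tendsto (fun x => |φ x|) (𝓝[>] p) atTop) →
    (∀ q : ℝ, C = Ioo p q →
      (∃ ℓ : ℝ, ℓ ^ 3 + (A' : ℝ) * ℓ + (B' : ℝ) = 0 ∧ Tendsto φ (𝓝[<] q) (𝓝 ℓ)) ∨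
        Tendsto (fun x => |φ x|) (𝓝[<] q) atTop) →
    (C = Ioi p →
      (∃ ℓ : ℝ, ℓ ^ 3 + (A' : ℝ) * ℓ + (B' : ℝ) = 0 ∧ Tendsto φ atTop (𝓝 ℓ)) ∨
        Tendsto (fun x => |φ x|) atTop atTop) →
    ∃ u : ℝ, u ^ 3 + (A' : ℝ) * u + (B' : ℝ) = 0 ∧
      (φ '' C = Ioi u ∨
        ∃ v : ℝ, v ^ 3 + (A' : ℝ) * v + (B' : ℝ) = 0 ∧ u < v ∧ φ '' C = Ioo u v) := by
  sorry

/-- STUB (K, the two components of `{P > 0}`). An interval `(u, ∞)` inside `{P > 0}` starting at a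
root is the unbounded component `U`; an interval `(u, v)` inside `{P > 0}` between two roots is the
egg `{P > 0} ∖ U`. -/
theorem stub_cubicComponents : ∀ (A B : ℤ), 4 * A ^ 3 + 27 * B ^ 2 ≠ 0 →
    ∀ (U : Set ℝ), U = connectedComponentIn {y : ℝ | 0 < y ^ 3 + (A : ℝ) * y + (B : ℝ)}
      (1 + |(A : ℝ)| + |(B : ℝ)|) →
    ∀ u : ℝ, u ^ 3 + (A : ℝ) * u + (B : ℝ) = 0 →
      (Ioi u ⊆ {y : ℝ | 0 < y ^ 3 + (A : ℝ) * y + (B : ℝ)} → Ioi u = U) ∧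
      ∀ v : ℝ, v ^ 3 + (A : ℝ) * v + (B : ℝ) = 0 → u < v →
        Ioo u v ⊆ {y : ℝ | 0 < y ^ 3 + (A : ℝ) * y + (B : ℝ)} →
        Ioo u v = {y : ℝ | 0 < y ^ 3 + (A : ℝ) * y + (B : ℝ)} \ U := by
  sorry

/-- STUB (M, one cell = one move of rule (2)). Along `Φ(x) = R(x 0)` the representations
`[cell, a/√P]` and `[R(cell), (a/|c|)/√P']` differ by a relation (one `changeOfVariablesRel`
instance: Jacobian identity `a/√P = (a/|c|)·|R'|/√(P'∘R)` from the datum identity). -/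
theorem stub_cellMove : ∀ (A B A' B' : ℤ) (f g : ℚ[X]) (c : ℚ),
    derivative f * g - f * derivative g ≠ 0 →
    C (c ^ 2) * g * (f ^ 3 + C (A' : ℚ) * f * g ^ 2 + C (B' : ℚ) * g ^ 3) =
      (X ^ 3 + C (A : ℚ) * X + C (B : ℚ)) * (derivative f * g - f * derivative g) ^ 2 →
    ∀ (R W : ℝ → ℝ) (L : Set ℝ), R = (fun y => aeval y f / aeval y g) →
      W = (fun y => aeval y (derivative f * g - f * derivative g)) →
      L = {y : ℝ | 0 < y ^ 3 + (A : ℝ) * y + (B : ℝ) ∧ W y ≠ 0} →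
    ∀ x₀ ∈ L, InjOn R (connectedComponentIn L x₀) →
      ∀ (a : ℚ) (rI t : KZ.IntegralRep 1),
        rI.domain = {x | x 0 ∈ connectedComponentIn L x₀} →
        EqOn rI.integrand (fun x => (a : ℝ) / Real.sqrt (x 0 ^ 3 + (A : ℝ) * x 0 + (B : ℝ)))
          rI.domain →
        t.domain = {x | x 0 ∈ R '' connectedComponentIn L x₀} →
        EqOn t.integrand
          (fun x => ((a / |c| : ℚ) : ℝ) / Real.sqrt (x 0 ^ 3 + (A' : ℝ) * x 0 + (B' : ℝ))) t.domain →
        KZ.of rI - KZ.of t ∈ KZ.relations := by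
  sorry

/-- STUB (C, census = finite domain additivity + grouping + integrand merges). For a saturated
source piece `K ⊆ {P > 0}` all of whose cells are mapped injectively onto `U'` or the egg `E'` and
moved by rule (2): `[K, a/√P] ≡ [U', (m_U a/|c|)/√P'] + [E', (m_E a/|c|)/√P']`, with `m_E = 0` when
every cell lands on `U'`. -/
theorem stub_cellCensus : ∀ (A B A' B' : ℤ) (f g : ℚ[X]) (c : ℚ),
    derivative f * g - f * derivative g ≠ 0 →
    C (c ^ 2) * g * (f ^ 3 + C (A' : ℚ) * f * g ^ 2 + C (B' : ℚ) * g ^ 3) =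
      (X ^ 3 + C (A : ℚ) * X + C (B : ℚ)) * (derivative f * g - f * derivative g) ^ 2 →
    ∀ (R W : ℝ → ℝ) (L : Set ℝ), R = (fun y => aeval y f / aeval y g) →
      W = (fun y => aeval y (derivative f * g - f * derivative g)) →
      L = {y : ℝ | 0 < y ^ 3 + (A : ℝ) * y + (B : ℝ) ∧ W y ≠ 0} →
    ∀ (U' E' : Set ℝ), U' = connectedComponentIn {y : ℝ | 0 < y ^ 3 + (A' : ℝ) * y + (B' : ℝ)}
        (1 + |(A' : ℝ)| + |(B' : ℝ)|) →
      E' = {y : ℝ | 0 < y ^ 3 + (A' : ℝ) * y + (B' : ℝ)} \ U' →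
    ∀ (K : Set ℝ), K ⊆ {y : ℝ | 0 < y ^ 3 + (A : ℝ) * y + (B : ℝ)} →
      IsSemialgebraic ℚ {x : Fin 1 → ℝ | x 0 ∈ K} →
      (∀ x₀ ∈ L, x₀ ∈ K → connectedComponentIn L x₀ ⊆ K) →
      (∀ x₀ ∈ L, x₀ ∈ K → InjOn R (connectedComponentIn L x₀) ∧
        (R '' connectedComponentIn L x₀ = U' ∨ R '' connectedComponentIn L x₀ = E')) →
      (∀ x₀ ∈ L, x₀ ∈ K → ∀ (a : ℚ) (rI t : KZ.IntegralRep 1),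
          rI.domain = {x | x 0 ∈ connectedComponentIn L x₀} →
          EqOn rI.integrand (fun x => (a : ℝ) / Real.sqrt (x 0 ^ 3 + (A : ℝ) * x 0 + (B : ℝ)))
            rI.domain →
          t.domain = {x | x 0 ∈ R '' connectedComponentIn L x₀} →
          EqOn t.integrand
            (fun x => ((a / |c| : ℚ) : ℝ) / Real.sqrt (x 0 ^ 3 + (A' : ℝ) * x 0 + (B' : ℝ)))
            t.domain →
          KZ.of rI - KZ.of t ∈ KZ.relations) →
      IntegrableOn (fun x : Fin 1 → ℝ => 1 / Real.sqrt (x 0 ^ 3 + (A' : ℝ) * x 0 + (B' : ℝ)))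
        {x : Fin 1 → ℝ | 0 < x 0 ^ 3 + (A' : ℝ) * x 0 + (B' : ℝ)} →
      ∃ mU mE : ℕ,
        ((∀ x₀ ∈ L, x₀ ∈ K → R '' connectedComponentIn L x₀ = U') → mE = 0) ∧
        ∀ (a : ℚ) (ρ : KZ.IntegralRep 1), ρ.domain = {x | x 0 ∈ K} →
          EqOn ρ.integrand (fun x => (a : ℝ) / Real.sqrt (x 0 ^ 3 + (A : ℝ) * x 0 + (B : ℝ)))
            ρ.domain →
          ∃ u e : KZ.IntegralRep 1,
            u.domain = {x | x 0 ∈ U'} ∧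
            EqOn u.integrand
              (fun x => ((mU * a / |c| : ℚ) : ℝ) / Real.sqrt (x 0 ^ 3 + (A' : ℝ) * x 0 + (B' : ℝ)))
              u.domain ∧
            e.domain = {x | x 0 ∈ E'} ∧
            EqOn e.integrand
              (fun x => ((mE * a / |c| : ℚ) : ℝ) / Real.sqrt (x 0 ^ 3 + (A' : ℝ) * x 0 + (B' : ℝ)))
              e.domain ∧
            KZ.of ρ - KZ.of u - KZ.of e ∈ KZ.relations := by
  sorry

/-- STUB (D, the duplication datum). `[2]` on `y² = x³ + Ax + B` is a datum `(f₂, g₂, 2)` of the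
crux's shape (Wronskian non-zero, certificate identity), coprime when `4A³ + 27B² ≠ 0`, and its x-map
dominates every real root of `P` on `{P > 0}` (2-descent square identity). -/
theorem stub_dupDatum : ∀ (A B : ℤ) (f₂ g₂ : ℚ[X]),
    f₂ = X ^ 4 - C (2 * (A : ℚ)) * X ^ 2 - C (8 * (B : ℚ)) * X + C ((A : ℚ) ^ 2) →
    g₂ = C 4 * (X ^ 3 + C (A : ℚ) * X + C (B : ℚ)) →
    derivative f₂ * g₂ - f₂ * derivative g₂ ≠ 0 ∧
    C ((2 : ℚ) ^ 2) * g₂ * (f₂ ^ 3 + C (A : ℚ) * f₂ * g₂ ^ 2 + C (B : ℚ) * g₂ ^ 3) =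
      (X ^ 3 + C (A : ℚ) * X + C (B : ℚ)) * (derivative f₂ * g₂ - f₂ * derivative g₂) ^ 2 ∧
    (4 * A ^ 3 + 27 * B ^ 2 ≠ 0 → IsCoprime f₂ g₂) ∧
    ∀ e x : ℝ, e ^ 3 + (A : ℝ) * e + (B : ℝ) = 0 → 0 < x ^ 3 + (A : ℝ) * x + (B : ℝ) →
      e ≤ aeval x f₂ / aeval x g₂ := by
  sorry

/-! ## Composition -/

section Composition

variable {A B A' B' : ℤ} {f g : ℚ[X]} {c : ℚ}

/-! ### Every cell is mapped injectively onto a whole component of `{P' > 0}` -/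

/-- The image of every cell of a COPRIME datum is the unbounded component `U'` of `{P' > 0}`, or its
egg, the latter lying strictly below a root of `P'`. -/
theorem cell_image (hΔ' : 4 * A' ^ 3 + 27 * B' ^ 2 ≠ 0)
    (hW : derivative f * g - f * derivative g ≠ 0)
    (hI : C (c ^ 2) * g * (f ^ 3 + C (A' : ℚ) * f * g ^ 2 + C (B' : ℚ) * g ^ 3) =
      (X ^ 3 + C (A : ℚ) * X + C (B : ℚ)) * (derivative f * g - f * derivative g) ^ 2)
    (hcop : IsCoprime f g) {x₀ : ℝ}
    (hx₀ : x₀ ∈ {y : ℝ | 0 < y ^ 3 + (A : ℝ) * y + (B : ℝ) ∧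
      aeval y (derivative f * g - f * derivative g) ≠ 0}) :
    InjOn (fun y => aeval y f / aeval y g) (connectedComponentIn {y : ℝ | 0 < y ^ 3 + (A : ℝ) * y + (B : ℝ) ∧
      aeval y (derivative f * g - f * derivative g) ≠ 0} x₀) ∧
    ((fun y => aeval y f / aeval y g) '' connectedComponentIn {y : ℝ | 0 < y ^ 3 + (A : ℝ) * y + (B : ℝ) ∧
        aeval y (derivative f * g - f * derivative g) ≠ 0} x₀ =
        connectedComponentIn {y : ℝ | 0 < y ^ 3 + (A' : ℝ) * y + (B' : ℝ)} (1 + |(A' : ℝ)| + |(B' : ℝ)|) ∨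
      ((fun y => aeval y f / aeval y g) '' connectedComponentIn {y : ℝ | 0 < y ^ 3 + (A : ℝ) * y + (B : ℝ) ∧
          aeval y (derivative f * g - f * derivative g) ≠ 0} x₀ =
          {y : ℝ | 0 < y ^ 3 + (A' : ℝ) * y + (B' : ℝ)} \
            connectedComponentIn {y : ℝ | 0 < y ^ 3 + (A' : ℝ) * y + (B' : ℝ)} (1 + |(A' : ℝ)| + |(B' : ℝ)|) ∧
        ∃ v : ℝ, v ^ 3 + (A' : ℝ) * v + (B' : ℝ) = 0 ∧
          ∀ y ∈ (fun y => aeval y f / aeval y g) '' connectedComponentIn {y : ℝ | 0 < y ^ 3 + (A : ℝ) * y + (B : ℝ) ∧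
            aeval y (derivative f * g - f * derivative g) ≠ 0} x₀, y < v)) := by
  set R : ℝ → ℝ := fun y => aeval y f / aeval y g with hR
  set W : ℝ → ℝ := fun y => aeval y (derivative f * g - f * derivative g) with hWd
  set L : Set ℝ := {y : ℝ | 0 < y ^ 3 + (A : ℝ) * y + (B : ℝ) ∧
    aeval y (derivative f * g - f * derivative g) ≠ 0} with hL
  have hL' : L = {y : ℝ | 0 < y ^ 3 + (A : ℝ) * y + (B : ℝ) ∧ W y ≠ 0} := by rw [hL]
  obtain ⟨hloc, hmono, p, hpx, hpW, hshape⟩ :=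
    stub_cellMonotone A B A' B' f g c hW hI R W L hR hWd hL' x₀ hx₀
  obtain ⟨hends, hinf⟩ := stub_cellEnds A B A' B' f g c hW hI hcop R W hR hWd
  have hx₀C : x₀ ∈ connectedComponentIn L x₀ := mem_connectedComponentIn hx₀
  have hinj : InjOn R (connectedComponentIn L x₀) := by
    rcases hmono with h | h
    · exact h.injOn
    · exact h.injOn
  refine ⟨hinj, ?_⟩
  have hcont : ContinuousOn R (connectedComponentIn L x₀) := fun x hx =>
    (hloc x hx).2.2.continuousAt.continuousWithinAt
  have hsub : R '' connectedComponentIn L x₀ ⊆ {y : ℝ | 0 < y ^ 3 + (A' : ℝ) * y + (B' : ℝ)} := by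
    rintro _ ⟨x, hx, rfl⟩
    exact (hloc x hx).2.1
  have hCshape : connectedComponentIn L x₀ = Ioi p ∨
      ∃ q : ℝ, p < q ∧ connectedComponentIn L x₀ = Ioo p q := by
    rcases hshape with h | ⟨q, hxq, _, h⟩
    · exact Or.inl h
    · exact Or.inr ⟨q, hpx.trans hxq, h⟩
  -- one-sided limits from the punctured ones
  have mono_ne : ∀ {p : ℝ} {s : Set ℝ}, s ⊆ {p}ᶜ → 𝓝[s] p ≤ 𝓝[≠] p := fun h => nhdsWithin_mono _ h
  have hleft : (∃ ℓ : ℝ, ℓ ^ 3 + (A' : ℝ) * ℓ + (B' : ℝ) = 0 ∧ Tendsto R (𝓝[>] p) (𝓝 ℓ)) ∨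
      Tendsto (fun x => |R x|) (𝓝[>] p) atTop := by
    rcases hends p hpW with ⟨ℓ, hℓ, ht⟩ | ht
    · exact Or.inl ⟨ℓ, hℓ, ht.mono_left (mono_ne fun x hx => ne_of_gt hx)⟩
    · exact Or.inr (ht.mono_left (mono_ne fun x hx => ne_of_gt hx))
  -- the right end `q` of a bounded cell satisfies `P(q)·W(q) = 0`
  have hqW : ∀ q : ℝ, connectedComponentIn L x₀ = Ioo p q →
      (q ^ 3 + (A : ℝ) * q + (B : ℝ)) * W q = 0 := by
    intro q hq
    have hx₀q : p < x₀ ∧ x₀ < q := by rw [hq] at hx₀C; exact hx₀C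
    rcases hshape with h | ⟨q', hxq', hq'W, h⟩
    · exfalso
      have hmem : q + 1 ∈ Ioi p := by
        show p < q + 1
        linarith [hx₀q.1, hx₀q.2]
      rw [← h, hq] at hmem
      linarith [hmem.2]
    · have e1 : Ioo p q = Ioo p q' := hq.symm.trans h
      have h1 := (Set.Ioo_subset_Ioo_iff (hx₀q.1.trans hx₀q.2)).1 e1.le
      have h2 := (Set.Ioo_subset_Ioo_iff (hpx.trans hxq')).1 e1.ge
      have hqq : q = q' := le_antisymm h1.2 h2.2
      rw [hqq]; exact hq'W
  have hright : ∀ q : ℝ, connectedComponentIn L x₀ = Ioo p q →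
      (∃ ℓ : ℝ, ℓ ^ 3 + (A' : ℝ) * ℓ + (B' : ℝ) = 0 ∧ Tendsto R (𝓝[<] q) (𝓝 ℓ)) ∨
        Tendsto (fun x => |R x|) (𝓝[<] q) atTop := by
    intro q hq
    rcases hends q (hqW q hq) with ⟨ℓ, hℓ, ht⟩ | ht
    · exact Or.inl ⟨ℓ, hℓ, ht.mono_left (mono_ne fun x hx => ne_of_lt hx)⟩
    · exact Or.inr (ht.mono_left (mono_ne fun x hx => ne_of_lt hx))
  have hinf' : connectedComponentIn L x₀ = Ioi p →
      (∃ ℓ : ℝ, ℓ ^ 3 + (A' : ℝ) * ℓ + (B' : ℝ) = 0 ∧ Tendsto R atTop (𝓝 ℓ)) ∨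
        Tendsto (fun x => |R x|) atTop atTop := fun _ => hinf
  obtain ⟨u, hu, himg⟩ := stub_intervalImage A' B' R (connectedComponentIn L x₀)
    p hCshape hcont hmono hsub hleft hright hinf'
  obtain ⟨hK1, hK2⟩ := stub_cubicComponents A' B' hΔ' _ rfl u hu
  rcases himg with h | ⟨v, hv, huv, h⟩
  · left
    rw [h]
    exact hK1 (h ▸ hsub)
  · right
    refine ⟨?_, v, hv, fun y hy => ?_⟩
    · rw [h]; exact hK2 v hv huv (h ▸ hsub)
    · rw [h] at hy; exact hy.2

/-- A cell lies in `{P > 0}`. -/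
theorem cell_subset_pos (A B : ℤ) (f g : ℚ[X]) (x₀ : ℝ) :
    connectedComponentIn {y : ℝ | 0 < y ^ 3 + (A : ℝ) * y + (B : ℝ) ∧
      aeval y (derivative f * g - f * derivative g) ≠ 0} x₀ ⊆
      {y : ℝ | 0 < y ^ 3 + (A : ℝ) * y + (B : ℝ)} :=
  (connectedComponentIn_subset _ _).trans fun _ h => h.1

/-- A cell meeting the unbounded component lies in it (saturation). -/
theorem cell_subset_unbounded (A B : ℤ) (f g : ℚ[X]) {x₀ : ℝ}
    (hx₀ : x₀ ∈ {y : ℝ | 0 < y ^ 3 + (A : ℝ) * y + (B : ℝ) ∧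
      aeval y (derivative f * g - f * derivative g) ≠ 0})
    (hK : x₀ ∈ connectedComponentIn {y : ℝ | 0 < y ^ 3 + (A : ℝ) * y + (B : ℝ)} (1 + |(A : ℝ)| + |(B : ℝ)|)) :
    connectedComponentIn {y : ℝ | 0 < y ^ 3 + (A : ℝ) * y + (B : ℝ) ∧
      aeval y (derivative f * g - f * derivative g) ≠ 0} x₀ ⊆
      connectedComponentIn {y : ℝ | 0 < y ^ 3 + (A : ℝ) * y + (B : ℝ)} (1 + |(A : ℝ)| + |(B : ℝ)|) := by
  have h1 := (isPreconnected_connectedComponentIn).subset_connectedComponentIn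
      (mem_connectedComponentIn hx₀) (cell_subset_pos A B f g x₀)
  rw [connectedComponentIn_eq hK]
  exact h1

/-- A cell meeting the egg lies in it (saturation). -/
theorem cell_subset_egg (A B : ℤ) (f g : ℚ[X]) {x₀ : ℝ}
    (hx₀ : x₀ ∈ {y : ℝ | 0 < y ^ 3 + (A : ℝ) * y + (B : ℝ) ∧
      aeval y (derivative f * g - f * derivative g) ≠ 0})
    (hK : x₀ ∈ {y : ℝ | 0 < y ^ 3 + (A : ℝ) * y + (B : ℝ)} \
      connectedComponentIn {y : ℝ | 0 < y ^ 3 + (A : ℝ) * y + (B : ℝ)} (1 + |(A : ℝ)| + |(B : ℝ)|)) :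
    connectedComponentIn {y : ℝ | 0 < y ^ 3 + (A : ℝ) * y + (B : ℝ) ∧
      aeval y (derivative f * g - f * derivative g) ≠ 0} x₀ ⊆
      {y : ℝ | 0 < y ^ 3 + (A : ℝ) * y + (B : ℝ)} \
        connectedComponentIn {y : ℝ | 0 < y ^ 3 + (A : ℝ) * y + (B : ℝ)} (1 + |(A : ℝ)| + |(B : ℝ)|) := by
  have h1 := (isPreconnected_connectedComponentIn).subset_connectedComponentIn
      (mem_connectedComponentIn hx₀) (cell_subset_pos A B f g x₀)
  refine h1.trans fun z hz => ⟨connectedComponentIn_subset _ _ hz, fun hzU => hK.2 ?_⟩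
  have e1 : connectedComponentIn {y : ℝ | 0 < y ^ 3 + (A : ℝ) * y + (B : ℝ)} x₀ =
      connectedComponentIn {y : ℝ | 0 < y ^ 3 + (A : ℝ) * y + (B : ℝ)} z := connectedComponentIn_eq hz
  rw [connectedComponentIn_eq hzU, ← e1]
  exact mem_connectedComponentIn hK.1

/-! ### The duplication datum on the target curve -/

/-- Every cell of the duplication datum of a nonsingular curve is mapped injectively onto the
unbounded component. -/
theorem dup_cell_image (A B : ℤ) (hΔ : 4 * A ^ 3 + 27 * B ^ 2 ≠ 0) (f₂ g₂ : ℚ[X])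
    (hf₂ : f₂ = X ^ 4 - C (2 * (A : ℚ)) * X ^ 2 - C (8 * (B : ℚ)) * X + C ((A : ℚ) ^ 2))
    (hg₂ : g₂ = C 4 * (X ^ 3 + C (A : ℚ) * X + C (B : ℚ))) {x₀ : ℝ}
    (hx₀ : x₀ ∈ {y : ℝ | 0 < y ^ 3 + (A : ℝ) * y + (B : ℝ) ∧
      aeval y (derivative f₂ * g₂ - f₂ * derivative g₂) ≠ 0}) :
    InjOn (fun y => aeval y f₂ / aeval y g₂) (connectedComponentIn {y : ℝ | 0 < y ^ 3 + (A : ℝ) * y + (B : ℝ) ∧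
      aeval y (derivative f₂ * g₂ - f₂ * derivative g₂) ≠ 0} x₀) ∧
    (fun y => aeval y f₂ / aeval y g₂) '' connectedComponentIn {y : ℝ | 0 < y ^ 3 + (A : ℝ) * y + (B : ℝ) ∧
        aeval y (derivative f₂ * g₂ - f₂ * derivative g₂) ≠ 0} x₀ =
      connectedComponentIn {y : ℝ | 0 < y ^ 3 + (A : ℝ) * y + (B : ℝ)} (1 + |(A : ℝ)| + |(B : ℝ)|) := by
  obtain ⟨hW₂, hI₂, hcop₂, hge⟩ := stub_dupDatum A B f₂ g₂ hf₂ hg₂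
  obtain ⟨hinj, himg⟩ := cell_image (c := 2) hΔ hW₂ hI₂ (hcop₂ hΔ) hx₀
  refine ⟨hinj, ?_⟩
  rcases himg with h | ⟨-, v, hv, hlt⟩
  · exact h
  · exfalso
    have h1 := hlt _ (mem_image_of_mem _ (mem_connectedComponentIn hx₀))
    exact absurd h1 (not_lt.2 (hge v x₀ hv hx₀.1))

/-! ### Representations with prescribed domain and integrand `s/√P` -/

/-- Existence of the representation `[D, s/√P]` for a `ℚ`-semialgebraic `D ⊆ {P > 0}`, integrability
being inherited from that of `dx/√P` on `{P > 0}`. -/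
theorem exists_rep (A B : ℤ) (s : ℚ) {D : Set (Fin 1 → ℝ)} (hD : IsSemialgebraic ℚ D)
    (hDS : D ⊆ {x : Fin 1 → ℝ | 0 < x 0 ^ 3 + (A : ℝ) * x 0 + (B : ℝ)})
    (hint : IntegrableOn (fun x : Fin 1 → ℝ => 1 / Real.sqrt (x 0 ^ 3 + (A : ℝ) * x 0 + (B : ℝ)))
      {x : Fin 1 → ℝ | 0 < x 0 ^ 3 + (A : ℝ) * x 0 + (B : ℝ)}) :
    ∃ ρ : KZ.IntegralRep 1, ρ.domain = D ∧
      ρ.integrand = fun x => (s : ℝ) / Real.sqrt (x 0 ^ 3 + (A : ℝ) * x 0 + (B : ℝ)) := by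
  have hmeas : MeasurableSet D :=
    Literature.ModelTheory.ExponentialFields.IsSemialgebraic.measurableSet_holds hD
  refine ⟨⟨D, fun x => (s : ℝ) / Real.sqrt (x 0 ^ 3 + (A : ℝ) * x 0 + (B : ℝ)), hD,
    (XMapPeriodTransferValue.isSemialgebraicFunOn_integrand A B s).mono hDS hD, ?_⟩, rfl, rfl⟩
  have h1 : IntegrableOn (fun x : Fin 1 → ℝ => (s : ℝ) * (1 / Real.sqrt (x 0 ^ 3 + (A : ℝ) * x 0 + (B : ℝ)))) D :=
    (hint.mono_set hDS).const_mul (s : ℝ)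
  refine h1.congr_fun (fun x _ => ?_) hmeas
  ring

/-- Value of a representation `[D, s/√P]`. -/
theorem value_rep {A B : ℤ} {s : ℚ} {D : Set (Fin 1 → ℝ)} (ρ : KZ.IntegralRep 1) (hd : ρ.domain = D)
    (he : EqOn ρ.integrand (fun x => (s : ℝ) / Real.sqrt (x 0 ^ 3 + (A : ℝ) * x 0 + (B : ℝ))) ρ.domain) :
    ρ.value = (s : ℝ) * ∫ x in D, 1 / Real.sqrt (x 0 ^ 3 + (A : ℝ) * x 0 + (B : ℝ)) := by
  rw [KZ.IntegralRep.value, setIntegral_congr_fun (KZ.IntegralRep.measurableSet_domain_holds ρ) he, hd,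
    ← integral_const_mul]
  congr 1; ext x; ring

/-- The unbounded-component period is positive. -/
theorem unbounded_period_pos (A B : ℤ)
    (hint : IntegrableOn (fun x : Fin 1 → ℝ => 1 / Real.sqrt (x 0 ^ 3 + (A : ℝ) * x 0 + (B : ℝ)))
      {x : Fin 1 → ℝ | 0 < x 0 ^ 3 + (A : ℝ) * x 0 + (B : ℝ)}) :
    0 < ∫ x in {x : Fin 1 → ℝ | x 0 ∈ connectedComponentIn {y : ℝ | 0 < y ^ 3 + (A : ℝ) * y + (B : ℝ)}
      (1 + |(A : ℝ)| + |(B : ℝ)|)}, 1 / Real.sqrt (x 0 ^ 3 + (A : ℝ) * x 0 + (B : ℝ)) := by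
  set U := connectedComponentIn {y : ℝ | 0 < y ^ 3 + (A : ℝ) * y + (B : ℝ)} (1 + |(A : ℝ)| + |(B : ℝ)|)
    with hU
  have hUopen : IsOpen U := (isOpen_lt continuous_const (by fun_prop)).connectedComponentIn
  have hopen : IsOpen {x : Fin 1 → ℝ | x 0 ∈ U} := hUopen.preimage (continuous_apply 0)
  have hmeas : MeasurableSet {x : Fin 1 → ℝ | x 0 ∈ U} := hopen.measurableSet
  have hUS : U ⊆ {y : ℝ | 0 < y ^ 3 + (A : ℝ) * y + (B : ℝ)} := connectedComponentIn_subset _ _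
  have hsubS : {x : Fin 1 → ℝ | x 0 ∈ U} ⊆ {x : Fin 1 → ℝ | 0 < x 0 ^ 3 + (A : ℝ) * x 0 + (B : ℝ)} :=
    fun x hx => hUS hx
  have hM : (1 + |(A : ℝ)| + |(B : ℝ)|) ∈ U :=
    mem_connectedComponentIn (stub_cellsBasic.1 A B _ le_rfl)
  rw [setIntegral_pos_iff_support_of_nonneg_ae ?_ (hint.mono_set hsubS)]
  · have hsub : {x : Fin 1 → ℝ | x 0 ∈ U} ⊆
        Function.support (fun x : Fin 1 → ℝ => 1 / Real.sqrt (x 0 ^ 3 + (A : ℝ) * x 0 + (B : ℝ))) ∩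
          {x : Fin 1 → ℝ | x 0 ∈ U} := by
      intro x hx
      refine ⟨?_, hx⟩
      simp only [Function.mem_support, ne_eq, one_div, inv_eq_zero]
      exact (Real.sqrt_pos.mpr (hUS hx)).ne'
    refine lt_of_lt_of_le ?_ (measure_mono hsub)
    exact hopen.measure_pos volume ⟨fun _ => 1 + |(A : ℝ)| + |(B : ℝ)|, hM⟩
  · filter_upwards [ae_restrict_mem hmeas] with x hx
    exact div_nonneg zero_le_one (Real.sqrt_nonneg _)

/-! ### The transfer for a coprime datum -/

/-- **The crux for a COPRIME datum.** -/
theorem transfer_of_coprime (A B A' B' : ℤ) (hΔ' : 4 * A' ^ 3 + 27 * B' ^ 2 ≠ 0) (f g : ℚ[X]) (c : ℚ)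
    (hcop : IsCoprime f g) (hW : derivative f * g - f * derivative g ≠ 0)
    (hI : C (c ^ 2) * g * (f ^ 3 + C (A' : ℚ) * f * g ^ 2 + C (B' : ℚ) * g ^ 3) =
      (X ^ 3 + C (A : ℚ) * X + C (B : ℚ)) * (derivative f * g - f * derivative g) ^ 2)
    (a b : ℚ) (hb : 0 < b) (r r' : KZ.IntegralRep 1)
    (h1 : r.domain = {x | 0 < x 0 ^ 3 + (A : ℝ) * x 0 + (B : ℝ)})
    (h2 : EqOn r.integrand (fun x => (a : ℝ) / Real.sqrt (x 0 ^ 3 + (A : ℝ) * x 0 + (B : ℝ))) r.domain)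
    (h3 : r'.domain = {x | 0 < x 0 ^ 3 + (A' : ℝ) * x 0 + (B' : ℝ)})
    (h4 : EqOn r'.integrand (fun x => (b : ℝ) / Real.sqrt (x 0 ^ 3 + (A' : ℝ) * x 0 + (B' : ℝ)))
      r'.domain)
    (h5 : r.value = r'.value) : KZ.Equivalent r r' := by
  obtain ⟨hlarge, hsaS, -, hsaU, hsaE, -, -⟩ := stub_cellsBasic
  -- integrability of `dx/√P'` on `{P' > 0}`, inherited from `r'`
  have hintP' : IntegrableOn (fun x : Fin 1 → ℝ => 1 / Real.sqrt (x 0 ^ 3 + (A' : ℝ) * x 0 + (B' : ℝ)))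
      {x : Fin 1 → ℝ | 0 < x 0 ^ 3 + (A' : ℝ) * x 0 + (B' : ℝ)} :=
    XMapPeriodTransferValue.integrableOn_of_rep r' h3 h4 hb.ne'
  -- names for the objects of the line
  set S' : Set ℝ := {y : ℝ | 0 < y ^ 3 + (A' : ℝ) * y + (B' : ℝ)} with hS'
  set U' : Set ℝ := connectedComponentIn S' (1 + |(A' : ℝ)| + |(B' : ℝ)|) with hU'
  set E' : Set ℝ := S' \ U' with hE'
  set R : ℝ → ℝ := fun y => aeval y f / aeval y g with hR
  set W : ℝ → ℝ := fun y => aeval y (derivative f * g - f * derivative g) with hWd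
  set L : Set ℝ := {y : ℝ | 0 < y ^ 3 + (A : ℝ) * y + (B : ℝ) ∧
    aeval y (derivative f * g - f * derivative g) ≠ 0} with hL
  have hL' : L = {y : ℝ | 0 < y ^ 3 + (A : ℝ) * y + (B : ℝ) ∧ W y ≠ 0} := by rw [hL]
  -- the duplication datum on the target
  set f₂ : ℚ[X] := X ^ 4 - C (2 * (A' : ℚ)) * X ^ 2 - C (8 * (B' : ℚ)) * X + C ((A' : ℚ) ^ 2) with hf₂
  set g₂ : ℚ[X] := C 4 * (X ^ 3 + C (A' : ℚ) * X + C (B' : ℚ)) with hg₂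
  obtain ⟨hW₂, hI₂, -, -⟩ := stub_dupDatum A' B' f₂ g₂ hf₂ hg₂
  set R₂ : ℝ → ℝ := fun y => aeval y f₂ / aeval y g₂ with hR₂
  set W₂ : ℝ → ℝ := fun y => aeval y (derivative f₂ * g₂ - f₂ * derivative g₂) with hW₂d
  set L₂ : Set ℝ := {y : ℝ | 0 < y ^ 3 + (A' : ℝ) * y + (B' : ℝ) ∧
    aeval y (derivative f₂ * g₂ - f₂ * derivative g₂) ≠ 0} with hL₂
  have hL₂' : L₂ = {y : ℝ | 0 < y ^ 3 + (A' : ℝ) * y + (B' : ℝ) ∧ W₂ y ≠ 0} := by rw [hL₂]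
  have hU'S : U' ⊆ S' := connectedComponentIn_subset _ _
  have hE'S : E' ⊆ S' := Set.sdiff_subset
  have hUS : {x : Fin 1 → ℝ | x 0 ∈ U'} ⊆ {x : Fin 1 → ℝ | 0 < x 0 ^ 3 + (A' : ℝ) * x 0 + (B' : ℝ)} :=
    fun x hx => hU'S hx
  have hES : {x : Fin 1 → ℝ | x 0 ∈ E'} ⊆ {x : Fin 1 → ℝ | 0 < x 0 ^ 3 + (A' : ℝ) * x 0 + (B' : ℝ)} :=
    fun x hx => hE'S hx
  -- CENSUS 1: the datum on the whole of `{P > 0}`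
  obtain ⟨mU, mE, -, hcens⟩ := stub_cellCensus A B A' B' f g c hW hI R W L hR hWd hL' U' E' hU' hE'
    {y : ℝ | 0 < y ^ 3 + (A : ℝ) * y + (B : ℝ)} subset_rfl (hsaS A B)
    (fun x₀ _ _ => cell_subset_pos A B f g x₀)
    (fun x₀ hx₀ _ => by
      obtain ⟨hinj, himg⟩ := cell_image hΔ' hW hI hcop hx₀
      exact ⟨hinj, himg.imp id And.left⟩)
    (fun x₀ hx₀ _ => stub_cellMove A B A' B' f g c hW hI R W L hR hWd hL' x₀ hx₀
      (cell_image hΔ' hW hI hcop hx₀).1)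
    hintP'
  -- CENSUS 2 and 3: the duplication datum on `U'` and on `E'`
  have dup_census : ∀ (K : Set ℝ), K ⊆ S' → IsSemialgebraic ℚ {x : Fin 1 → ℝ | x 0 ∈ K} →
      (∀ x₀ ∈ L₂, x₀ ∈ K → connectedComponentIn L₂ x₀ ⊆ K) →
      ∃ k : ℕ, ∀ (s : ℚ) (ρ : KZ.IntegralRep 1), ρ.domain = {x | x 0 ∈ K} →
        EqOn ρ.integrand (fun x => (s : ℝ) / Real.sqrt (x 0 ^ 3 + (A' : ℝ) * x 0 + (B' : ℝ))) ρ.domain →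
        ∃ u : KZ.IntegralRep 1, u.domain = {x | x 0 ∈ U'} ∧
          EqOn u.integrand
            (fun x => ((k * s / |(2 : ℚ)| : ℚ) : ℝ) / Real.sqrt (x 0 ^ 3 + (A' : ℝ) * x 0 + (B' : ℝ)))
            u.domain ∧
          KZ.of ρ - KZ.of u ∈ KZ.relations := by
    intro K hK hKsa hKsat
    obtain ⟨kU, kE, hkE, hc⟩ := stub_cellCensus A' B' A' B' f₂ g₂ 2 hW₂ hI₂ R₂ W₂ L₂ hR₂ hW₂d hL₂'
      U' E' hU' hE' K hK hKsa hKsat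
      (fun x₀ hx₀ _ => by
        obtain ⟨hinj, himg⟩ := dup_cell_image A' B' hΔ' f₂ g₂ hf₂ hg₂ hx₀
        exact ⟨hinj, Or.inl himg⟩)
      (fun x₀ hx₀ _ => stub_cellMove A' B' A' B' f₂ g₂ 2 hW₂ hI₂ R₂ W₂ L₂ hR₂ hW₂d hL₂' x₀ hx₀
        (dup_cell_image A' B' hΔ' f₂ g₂ hf₂ hg₂ hx₀).1)
      hintP'
    have hkE0 : kE = 0 := hkE fun x₀ hx₀ _ => (dup_cell_image A' B' hΔ' f₂ g₂ hf₂ hg₂ hx₀).2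
    refine ⟨kU, fun s ρ hρd hρe => ?_⟩
    obtain ⟨u, e, hud, hue, hed, hee, hrel⟩ := hc s ρ hρd hρe
    have he0 : KZ.of e ∈ KZ.relations := by
      refine KZ.of_mem_relations_of_eqOn_zero e fun x hx => ?_
      rw [hee hx, hkE0]
      simp
    refine ⟨u, hud, hue, ?_⟩
    have : KZ.of ρ - KZ.of u = (KZ.of ρ - KZ.of u - KZ.of e) + KZ.of e := by abel
    rw [this]
    exact KZ.relations.add_mem hrel he0
  obtain ⟨kU, hcU⟩ := dup_census U' hU'S (hsaU A' B')
    (fun x₀ hx₀ hK => cell_subset_unbounded A' B' f₂ g₂ hx₀ hK)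
  obtain ⟨kE, hcE⟩ := dup_census E' hE'S (hsaE A' B')
    (fun x₀ hx₀ hK => cell_subset_egg A' B' f₂ g₂ hx₀ hK)
  -- push `[r]` to `U'`
  obtain ⟨u, e, hud, hue, hed, hee, hrel⟩ := hcens a r h1 h2
  obtain ⟨u₁, hu₁d, hu₁e, hrel₁⟩ := hcU (mU * a / |c|) u hud hue
  obtain ⟨u₂, hu₂d, hu₂e, hrel₂⟩ := hcE (mE * a / |c|) e hed hee
  -- push `[r']` to `U'`
  have hUsub : {x : Fin 1 → ℝ | x 0 ∈ U'} ⊆ r'.domain := by rw [h3]; exact hUS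
  have hEsub : {x : Fin 1 → ℝ | x 0 ∈ E'} ⊆ r'.domain := by rw [h3]; exact hES
  set r'U : KZ.IntegralRep 1 := r'.restrict _ (hsaU A' B') hUsub with hr'U
  set r'E : KZ.IntegralRep 1 := r'.restrict _ (hsaE A' B') hEsub with hr'E
  have hsplit : KZ.of r' - KZ.of r'U - KZ.of r'E ∈ KZ.relations := by
    refine KZ.domainAddRel_subset_relations ⟨1, r', r'U, r'E, ?_, ?_, fun _ _ => rfl, fun _ _ => rfl, rfl⟩
    · rw [KZ.IntegralRep.domain_restrict, KZ.IntegralRep.domain_restrict, h3]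
      ext x
      have hx : x ∈ ({x | x 0 ∈ U'} ∪ {x | x 0 ∈ E'} : Set (Fin 1 → ℝ)) ↔ x 0 ∈ U' ∪ E' := by
        simp only [mem_union, mem_setOf_eq]
      rw [hx, hE', Set.union_sdiff_cancel hU'S]
      rfl
    · have he : r'U.domain ∩ r'E.domain = ∅ := by
        rw [KZ.IntegralRep.domain_restrict, KZ.IntegralRep.domain_restrict]
        ext x
        simp only [mem_inter_iff, mem_setOf_eq, mem_empty_iff_false, iff_false, not_and]
        exact fun hU hE => hE.2 hU
      rw [he, measure_empty]
  obtain ⟨u₃, hu₃d, hu₃e, hrel₃⟩ := hcU b r'U (by rw [hr'U, KZ.IntegralRep.domain_restrict])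
    (fun x hx => h4 (hUsub hx))
  obtain ⟨u₄, hu₄d, hu₄e, hrel₄⟩ := hcE b r'E (by rw [hr'E, KZ.IntegralRep.domain_restrict])
    (fun x hx => h4 (hEsub hx))
  -- merge on `U'`
  set γ : ℚ := kU * (mU * a / |c|) / |(2 : ℚ)| + kE * (mE * a / |c|) / |(2 : ℚ)| with hγ
  set γ' : ℚ := kU * b / |(2 : ℚ)| + kE * b / |(2 : ℚ)| with hγ'
  obtain ⟨V, hVd, hVi⟩ := exists_rep A' B' γ (hsaU A' B') hUS hintP'
  obtain ⟨V', hV'd, hV'i⟩ := exists_rep A' B' γ' (hsaU A' B') hUS hintP'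
  have hmerge : KZ.of V - KZ.of u₁ - KZ.of u₂ ∈ KZ.relations := by
    refine KZ.integrandAddRel_subset_relations ⟨1, V, u₁, u₂, hu₁d.trans hVd.symm, hu₂d.trans hVd.symm,
      fun x hx => ?_, rfl⟩
    rw [Pi.add_apply, hVi, hu₁e (hu₁d.symm ▸ hVd ▸ hx), hu₂e (hu₂d.symm ▸ hVd ▸ hx), hγ]
    push_cast
    ring
  have hmerge' : KZ.of V' - KZ.of u₃ - KZ.of u₄ ∈ KZ.relations := by
    refine KZ.integrandAddRel_subset_relations ⟨1, V', u₃, u₄, hu₃d.trans hV'd.symm, hu₄d.trans hV'd.symm,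
      fun x hx => ?_, rfl⟩
    rw [Pi.add_apply, hV'i, hu₃e (hu₃d.symm ▸ hV'd ▸ hx), hu₄e (hu₄d.symm ▸ hV'd ▸ hx), hγ']
    push_cast
    ring
  -- `[r] ≡ [V]` and `[r'] ≡ [V']`
  have hrV : KZ.Equivalent r V := by
    have : KZ.of r - KZ.of V = (KZ.of r - KZ.of u - KZ.of e) + (KZ.of u - KZ.of u₁) +
        (KZ.of e - KZ.of u₂) - (KZ.of V - KZ.of u₁ - KZ.of u₂) := by abel
    show KZ.of r - KZ.of V ∈ KZ.relations
    rw [this]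
    exact KZ.relations.sub_mem (KZ.relations.add_mem (KZ.relations.add_mem hrel hrel₁) hrel₂) hmerge
  have hr'V' : KZ.Equivalent r' V' := by
    have : KZ.of r' - KZ.of V' = (KZ.of r' - KZ.of r'U - KZ.of r'E) + (KZ.of r'U - KZ.of u₃) +
        (KZ.of r'E - KZ.of u₄) - (KZ.of V' - KZ.of u₃ - KZ.of u₄) := by abel
    show KZ.of r' - KZ.of V' ∈ KZ.relations
    rw [this]
    exact KZ.relations.sub_mem (KZ.relations.add_mem (KZ.relations.add_mem hsplit hrel₃) hrel₄) hmerge'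
  -- the unique use of `r.value = r'.value`: the two scalars on `U'` agree
  have hΩ := unbounded_period_pos A' B' hintP'
  have hvV := value_rep (A := A') (B := B') V hVd (by rw [hVi]; exact fun _ _ => rfl)
  have hvV' := value_rep (A := A') (B := B') V' hV'd (by rw [hV'i]; exact fun _ _ => rfl)
  have hγγ' : (γ : ℝ) = γ' := by
    have e1 : V.value = V'.value := by
      rw [← KZ.Equivalent.value_eq_holds hrV, ← KZ.Equivalent.value_eq_holds hr'V', h5]
    rw [hvV, hvV'] at e1
    exact mul_right_cancel₀ hΩ.ne' e1
  have hVV' : KZ.Equivalent V V' :=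
    XMapPeriodTransferValue.equivalent_of_eqOn V V' (hV'd.trans hVd.symm) fun x _ => by
      rw [hVi, hV'i]
      simp only [hγγ']
  exact (hrV.trans hVV').trans hr'V'.symm

end Composition

/-- **The crux `XMapPeriodTransfer`**, by name, from the registered stubs: reduce to coprime data
(`XMapPeriodTransferDatum.iff_coprime`) and apply `transfer_of_coprime`. -/
theorem XMapPeriodTransfer_of : XMapPeriodTransfer := by
  rw [XMapPeriodTransferDatum.iff_coprime]
  rintro A B A' B' - hΔ' ⟨f, g, c, hcop, hW, hI⟩ a b - hb r r' h1 h2 h3 h4 h5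
  exact transfer_of_coprime A B A' B' hΔ' f g c hcop hW hI a b hb r r' h1 h2 h3 h4 h5

end Summit.KontsevichZagierPeriods.IsogenyCertificates.XMapPeriodTransferCells

end
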